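import Summits.ResolutionOfSingularities.ResolutionOfSingularities.Theorems.FrobeniusClosingSteerRadicandCohenFrame
import HarnessLib

/-!
# Lemma S kernel, stage (T0): the Cohen frame of `Ŝ` ADAPTED to a given regular system of parameters of `S`
# (`φ : Ŝ ≃+* K⟦X_1, …, X_c⟧` with `φ(x_i) = X_i` and `constantCoeff ∘ φ = residue`)

W4.1 support file (crux `Steer`, stmt-ResolutionOfSingularities-16345; line `switching_dichotomy`), res-D-pv-007 AS
res-L0-w41-stub-5 — stage (T0) of the Lemma S kernel `…NoSatelliteStep` (plan-1 RULING 147c). The tree's Cohen theorem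
(`Literature.AlgebraicGeometry.Resolution.exists_ringEquiv_mvPowerSeries_residueField`, Matsumura 29.7, and its engine
`comp_map_bijective`) is re-run with a PRESCRIBED regular system of parameters `x : Fin c → S` of the regular local ring `S`
(`dim S = c`, characteristic `p`), giving the two bookkeeping identities the Lemma S / F♭ bridges consume:

* **`exists_adapted_cohenFrame`** — `∃ φ : Ŝ ≃+* K⟦X_{Fin c}⟧` (`K = κ(Ŝ)`) with `φ (x_i) = X_i` for all `i` and
  `constantCoeff (φ a) = residue a` for all `a ∈ Ŝ`;
* `exists_expansion` — the induced reading `E := φ ∘ (S → Ŝ) : S →+* K⟦X⟧` with `E (x_i) = X_i` and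
  `constantCoeff (E s) = residue (s)` read in `κ(Ŝ)` (the inputs `hE0`/`hres` of `ExpansionTransport.ringHom_comp_eq_of_generators`
  and `hιP`/`hι0` of `ChartRealisability.map_mem_monoidPowerSeries`).

OURS (campaign res-hironaka); nothing here is attributed to [Hironaka2017]. [cite: Matsumura1987, Thm. 29.7; Thm. 28.3]
-/

noncomputable section

-- `Summit.<S>.<S>.…` duplicates the summit name by design (single-problem summit).
set_option linter.dupNamespace false

open IsLocalRing

namespace Summit.ResolutionOfSingularities.ResolutionOfSingularities.Theorems.SwitchingDichotomy.NoSatelliteStep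

open Summit.ResolutionOfSingularities.ResolutionOfSingularities.Theorems.SwitchingDichotomy
open Literature.AlgebraicGeometry.Resolution

variable {S : Type} [CommRing S] [IsRegularLocalRing S]

/-- **The Cohen frame adapted to a given regular system of parameters.** For a regular local ring `S` of characteristic `p`
and dimension `c`, and `x : Fin c → S` generating `𝔪_S`: an isomorphism `φ : Ŝ ≃+* K⟦X_1, …, X_c⟧` over `K = κ(Ŝ)` with
`φ(x_i) = X_i` and whose constant-coefficient map is the residue map of `Ŝ`. OURS. [cite: Matsumura1987, Thm. 29.7] -/
theorem exists_adapted_cohenFrame (p : ℕ) [Fact p.Prime] [CharP S p] {c : ℕ} (hdim : ringKrullDim S = c) (x : Fin c → S)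
    (hx : Ideal.span (Set.range x) = maximalIdeal S) :
    ∃ φ : AdicCompletion (maximalIdeal S) S ≃+* MvPowerSeries (Fin c) (ResidueField (AdicCompletion (maximalIdeal S) S)),
      (∀ i, φ (algebraMap S (AdicCompletion (maximalIdeal S) S) (x i)) = MvPowerSeries.X i) ∧
      ∀ a, MvPowerSeries.constantCoeff (φ a) = residue (AdicCompletion (maximalIdeal S) S) a := by
  classical
  haveI : IsNoetherianRing (AdicCompletion (maximalIdeal S) S) := isNoetherianRing_adicCompletion_maximalIdeal S
  haveI : IsRegularLocalRing (AdicCompletion (maximalIdeal S) S) := isRegularLocalRing_adicCompletion S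
  haveI : CharP (AdicCompletion (maximalIdeal S) S) p := RadicandCohenFrame.charP_adicCompletion p S
  -- coefficient field over the prime field
  obtain ⟨σ, hσ⟩ := Literature.RingTheory.CompleteLocalRings.exists_ringHom_comp_residue_eq_id_of_subring
    (AdicCompletion (maximalIdeal S) S) (ZMod.castHom (dvd_refl p) (AdicCompletion (maximalIdeal S) S)).range
    (RadicandCohenFrame.isField_range_castHom p)
  -- the prescribed regular system of parameters, read in `Ŝ`
  let x' : Fin c → AdicCompletion (maximalIdeal S) S := fun i => algebraMap S (AdicCompletion (maximalIdeal S) S) (x i)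
  have hx' : Ideal.span (Set.range x') = maximalIdeal (AdicCompletion (maximalIdeal S) S) := by
    have hmap : maximalIdeal (AdicCompletion (maximalIdeal S) S) =
        (Ideal.span (Set.range x)).map (algebraMap S (AdicCompletion (maximalIdeal S) S)) := by
      rw [hx]; exact AdicCompletion.maximalIdeal_eq_map
    rw [hmap, Ideal.map_span, ← Set.range_comp]
    rfl
  have hx'm : ∀ i, x' i ∈ maximalIdeal (AdicCompletion (maximalIdeal S) S) := fun i => hx' ▸ Ideal.subset_span ⟨i, rfl⟩
  have hd : (maximalIdeal (AdicCompletion (maximalIdeal S) S)).spanFinrank = c := by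
    have h := RadicandCohenFrame.spanFinrank_maximalIdeal_adicCompletion_eq (S := S)
    rw [hdim] at h
    exact_mod_cast h
  obtain ⟨Φ, hΦ₁, hΦ₂⟩ := exists_adicEvalHom (maximalIdeal (AdicCompletion (maximalIdeal S) S)) x' hx'm
  have hbij := comp_map_bijective σ hσ hd x' hx' Φ hΦ₁ hΦ₂
  let ψ : MvPowerSeries (Fin c) (ResidueField (AdicCompletion (maximalIdeal S) S)) ≃+* AdicCompletion (maximalIdeal S) S :=
    RingEquiv.ofBijective _ hbij
  have hψ : ∀ F, ψ F = Φ (MvPowerSeries.map σ F) := fun F => rfl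
  refine ⟨ψ.symm, fun i => ?_, fun a => ?_⟩
  · -- `ψ (X i) = x' i`
    rw [RingEquiv.symm_apply_eq, hψ]
    change x' i = Φ (MvPowerSeries.map σ (MvPowerSeries.X i))
    rw [MvPowerSeries.map_X, ← MvPolynomial.coe_X, hΦ₁, MvPolynomial.eval_X]
  · -- `residue (ψ F) = constantCoeff F`
    have ha : a = ψ (ψ.symm a) := (RingEquiv.apply_symm_apply ψ a).symm
    generalize ψ.symm a = F at ha ⊢
    subst ha
    rw [hψ]
    set k := MvPowerSeries.constantCoeff F with hk
    have hsplit : MvPowerSeries.map σ F =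
        ((MvPolynomial.C (σ k) : MvPolynomial (Fin c) (AdicCompletion (maximalIdeal S) S)) :
          MvPowerSeries (Fin c) (AdicCompletion (maximalIdeal S) S)) +
        (MvPowerSeries.map σ F - MvPowerSeries.C (σ k)) := by
      rw [MvPolynomial.coe_C]; ring
    have hrest : Φ (MvPowerSeries.map σ F - MvPowerSeries.C (σ k)) ∈ maximalIdeal (AdicCompletion (maximalIdeal S) S) := by
      have h1 := hΦ₂ 1 (MvPowerSeries.map σ F - MvPowerSeries.C (σ k)) (fun e he => by
        have he0 : e = 0 := (Finsupp.degree_eq_zero_iff e).mp (Nat.lt_one_iff.mp he)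
        subst he0
        rw [map_sub, MvPowerSeries.coeff_map, MvPowerSeries.coeff_zero_eq_constantCoeff_apply, ← hk,
          MvPowerSeries.coeff_zero_eq_constantCoeff_apply, MvPowerSeries.constantCoeff_C, sub_self])
      rwa [pow_one] at h1
    rw [hsplit, map_add, hΦ₁, MvPolynomial.eval_C, map_add, hσ, (residue_eq_zero_iff _).mpr hrest, add_zero]

/-- **The adapted expansion map** `E = φ ∘ (S → Ŝ) : S →+* K⟦X_1, …, X_c⟧`: `E (x_i) = X_i` (so `E` sends `𝔪_S` to constant-free
series) and `constantCoeff (E s)` is the residue of `s` read in `κ(Ŝ)`. OURS. [cite: Matsumura1987, Thm. 29.7] -/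
theorem exists_expansion (p : ℕ) [Fact p.Prime] [CharP S p] {c : ℕ} (hdim : ringKrullDim S = c) (x : Fin c → S)
    (hx : Ideal.span (Set.range x) = maximalIdeal S) :
    ∃ (φ : AdicCompletion (maximalIdeal S) S ≃+* MvPowerSeries (Fin c) (ResidueField (AdicCompletion (maximalIdeal S) S)))
      (E : S →+* MvPowerSeries (Fin c) (ResidueField (AdicCompletion (maximalIdeal S) S))),
      (∀ s, E s = φ (algebraMap S (AdicCompletion (maximalIdeal S) S) s)) ∧ (∀ i, E (x i) = MvPowerSeries.X i) ∧
      ∀ s, MvPowerSeries.constantCoeff (E s) =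
        residue (AdicCompletion (maximalIdeal S) S) (algebraMap S (AdicCompletion (maximalIdeal S) S) s) := by
  obtain ⟨φ, hφx, hφc⟩ := exists_adapted_cohenFrame p hdim x hx
  exact ⟨φ, φ.toRingHom.comp (algebraMap S _), fun s => rfl, fun i => hφx i, fun s => hφc _⟩

end Summit.ResolutionOfSingularities.ResolutionOfSingularities.Theorems.SwitchingDichotomy.NoSatelliteStep

end
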